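import Summits.CriticalPhenomena.Ising3DConformalLimit.Theorems.RotationUpgradeFromTwoPoint.Negative.CubicDecoySymmetries
import Literature.Barriers.CriticalPhenomena.TwoPointLawNotMoebius

/-!
# `RotationUpgradeFromTwoPoint` (item stmt-CriticalPhenomena-8367): the cubic decoy is a lattice scaling limit, NOT rotation invariant, NOT reflection positive

Third file of the cubic decoy `cubicFamily Δ` (`Negative/CubicDecoy.lean`,
`Negative/CubicDecoySymmetries.lean`). The two decisive negatives and the lattice provenance:

* `cubicFamily_not_isRotationInvariant` (every `Δ`): the collinear quadruple `0, e₀, 2e₀, 3e₀`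
  against its image under the reflection `R₀` swapping `e₀` with the rational unit vector
  `u = (3/5, 4/5, 0)` (Mathlib `Submodule.reflection_sub`): `quartic` is `232` on the first and
  `232·337/625` on the second (`Σₖ uₖ⁴ = 337/625 ≠ 1`), while `sqSum`, `wick`, `bump` are `O(3)`
  invariant; the difference sits entirely in the CONNECTED four-point function
  (`limitConnectedFour_cubicFamily_R₀_ne`).
* `cubicFamily_hasPointwiseScalingLimit`: with `ρ δ = δ^{-Δ}` the decoy is the pointwise scaling
  limit of its own sampling `cubicLattice Δ` on `ℤ³` (scale covariance + continuity on
  `NonCoincident` + the barrier's `3δ` rounding/approximation lemmas).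
* `cubicFamily_not_reflectionPositive` (`Δ ≥ 0`, every axis): `S₆ ≡ 0 < S₄`, OS Cauchy–Schwarz —
  the model-blind no-go class is disjoint from reflection positivity, so OS-based lines
  (nine-mirror RP + continuation) are untouched by it.
Standing crux disprover (D-0016), cycle 1.
-/

noncomputable section

namespace Summit.CriticalPhenomena.Ising3DConformalLimit.RotationUpgradeFromTwoPointNegative

open Literature.Probability.LatticeModels Literature.Barriers.CriticalPhenomena
open Literature.MathematicalPhysics.QuantumFieldTheory
open Filter Set Function ScaleNotMoebius
open scoped Topology

/-! #### The decoy is NOT rotation invariant: an explicit orthogonal map outside `B₃` applied to a collinear quadruple -/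

/-- The unit vector `u = (3/5, 4/5, 0)` (a rational point of the sphere off the cubic axes and
diagonals). [folklore] -/
def uDir : (EuclideanSpace ℝ (Fin 3)) := WithLp.toLp 2 ![3 / 5, 4 / 5, 0]

/-- `‖u‖ = 1`. [folklore] -/
theorem norm_uDir : ‖uDir‖ = 1 := by
  rw [EuclideanSpace.norm_eq, Fin.sum_univ_three]
  have h0 : ‖uDir 0‖ ^ 2 = 9 / 25 := by simp [uDir]; norm_num
  have h1 : ‖uDir 1‖ ^ 2 = 16 / 25 := by simp [uDir]; norm_num
  have h2 : ‖uDir 2‖ ^ 2 = 0 := by simp [uDir]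
  rw [h0, h1, h2]
  norm_num

/-- The isometry `R₀`: the reflection swapping `e₀` and `u` (Mathlib `Submodule.reflection_sub`);
`-R₀ ∈ SO(3)` acts identically on every limit (`neg_free`). [folklore] -/
def R₀ : (EuclideanSpace ℝ (Fin 3)) ≃ₗᵢ[ℝ] (EuclideanSpace ℝ (Fin 3)) := (ℝ ∙ (axisUnit - uDir))ᗮ.reflection

/-- `R₀ e₀ = u`. [folklore] -/
theorem R₀_axisUnit : R₀ axisUnit = uDir :=
  Submodule.reflection_sub (by rw [norm_axisUnit, norm_uDir])

/-- `R₀ (t e₀) = t u`. [folklore] -/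
theorem R₀_axisPt (t : ℝ) : R₀ (axisPt t) = t • uDir := by
  rw [axisPt, LinearIsometryEquiv.map_smul, R₀_axisUnit]

/-- The collinear test quadruple `0, e₀, 2e₀, 3e₀` as multiples of `e₀`. [folklore] -/
theorem configU4_eq : configU4 = fun i => (![0, 1, 2, 3] : Fin 4 → ℝ) i • axisUnit := by
  funext i
  fin_cases i <;> simp [configU4, axisPt]

/-- Its image under `R₀`: `0, u, 2u, 3u`. [folklore] -/
theorem R₀_configU4 : (fun i => R₀ (configU4 i)) = fun i => (![0, 1, 2, 3] : Fin 4 → ℝ) i • uDir := by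
  funext i
  fin_cases i <;> simp [configU4, R₀_axisPt]

/-- `∑ᵢⱼ (tᵢ - tⱼ)⁴ = 232` for `t = (0,1,2,3)`. [folklore] -/
theorem sum_t_four : (∑ i : Fin 4, ∑ j : Fin 4,
    ((![0, 1, 2, 3] : Fin 4 → ℝ) i - (![0, 1, 2, 3] : Fin 4 → ℝ) j) ^ 4) = 232 := by
  simp [Fin.sum_univ_four]
  norm_num

/-- `∑ₖ (e₀)ₖ⁴ = 1`. [folklore] -/
theorem sum4_axisUnit : ∑ k, (axisUnit k) ^ 4 = 1 := by
  simp [axisUnit]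

/-- `∑ₖ uₖ⁴ = 337/625 ≠ 1`: the quartic cubic invariant separates `u` from the axes. [folklore] -/
theorem sum4_uDir : ∑ k, (uDir k) ^ 4 = 337 / 625 := by
  simp [uDir, Fin.sum_univ_three]
  norm_num

/-- `quartic` at the collinear quadruple. [folklore] -/
theorem quartic_configU4 : quartic configU4 = 232 := by
  rw [configU4_eq, quartic_line, sum_t_four, sum4_axisUnit, mul_one]

/-- `quartic` at the rotated quadruple. [folklore] -/
theorem quartic_R₀_configU4 : quartic (fun i => R₀ (configU4 i)) = 232 * (337 / 625) := by
  rw [R₀_configU4, quartic_line, sum_t_four, sum4_uDir]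

/-- **The decoy's `S₄` is not invariant under `R₀`** (for EVERY `Δ`). [folklore] -/
theorem cubicFamily_four_R₀_ne (Δ : ℝ) :
    cubicFamily Δ 4 (fun i => R₀ (configU4 i)) ≠ cubicFamily Δ 4 configU4 := by
  have hinj := configU4_injective
  have hinjR : Function.Injective (fun i => R₀ (configU4 i)) :=
    (injective_comp_iff R₀.injective _).2 hinj
  rw [cubicFamily_four_of_injective Δ hinjR, cubicFamily_four_of_injective Δ hinj, wick_map, bump_map,
    aniso, aniso, sqSum_map, quartic_configU4, quartic_R₀_configU4]
  have hb : 0 < bump Δ configU4 := bump_pos Δ hinj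
  have hs : 0 < sqSum configU4 ^ 2 := pow_pos (sqSum_pos hinj) 2
  intro h
  have h1 : bump Δ configU4 * (232 * (337 / 625) / sqSum configU4 ^ 2) =
      bump Δ configU4 * (232 / sqSum configU4 ^ 2) := by linarith
  have h2 := mul_left_cancel₀ hb.ne' h1
  rw [div_eq_div_iff hs.ne' hs.ne'] at h2
  nlinarith

/-- **The cubic decoy is not rotation invariant.** [folklore] -/
theorem cubicFamily_not_isRotationInvariant (Δ : ℝ) : ¬ IsRotationInvariant (cubicFamily Δ) :=
  fun h => cubicFamily_four_R₀_ne Δ (h 4 R₀ configU4)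

/-- … and more precisely its CONNECTED four-point function is not (the Wick part is round).
[folklore] -/
theorem limitConnectedFour_cubicFamily_R₀_ne (Δ : ℝ) :
    limitConnectedFour (cubicFamily Δ) (fun i => R₀ (configU4 i)) ≠
      limitConnectedFour (cubicFamily Δ) configU4 := by
  intro h
  have key : limitConnectedFour (cubicFamily Δ) (fun i => R₀ (configU4 i)) -
      limitConnectedFour (cubicFamily Δ) configU4 =
      cubicFamily Δ 4 (fun i => R₀ (configU4 i)) - cubicFamily Δ 4 configU4 := by
    simp only [limitConnectedFour, cubicFamily_two, Matrix.cons_val_zero, Matrix.cons_val_one, twoPt_map]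
    ring
  rw [h, sub_self] at key
  exact cubicFamily_four_R₀_ne Δ (by linarith)

/-! #### Clustering of the decoy -/

/-- `|U₄| ≤ bump` everywhere off the coincident locus. [folklore] -/
theorem abs_limitConnectedFour_cubicFamily_le_bump (Δ : ℝ) {x : Fin 4 → (EuclideanSpace ℝ (Fin 3))}
    (hx : Function.Injective x) : |limitConnectedFour (cubicFamily Δ) x| ≤ bump Δ x := by
  rw [limitConnectedFour_cubicFamily Δ hx, abs_neg,
    abs_of_nonneg (mul_nonneg (bump_nonneg Δ x) (aniso_nonneg x))]
  calc bump Δ x * aniso x ≤ bump Δ x * 1 :=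
        mul_le_mul_of_nonneg_left (aniso_le_one x) (bump_nonneg Δ x)
    _ = bump Δ x := mul_one _

/-- The bump of a quadruple whose second pair is translated far away tends to `0` (`Δ > 0`).
[folklore] -/
theorem tendsto_bump_translate {Δ : ℝ} (hΔ : 0 < Δ) (x₀ x₁ y₀ y₁ : (EuclideanSpace ℝ (Fin 3))) :
    Tendsto (fun a : (EuclideanSpace ℝ (Fin 3)) => bump Δ ![x₀, x₁, y₀ + a, y₁ + a]) (cocompact (EuclideanSpace ℝ (Fin 3))) (𝓝 0) := by
  -- `‖x₀ - (y₀ + a)‖ → ∞`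
  have hg : Tendsto (fun a : (EuclideanSpace ℝ (Fin 3)) => ‖x₀ - (y₀ + a)‖) (cocompact (EuclideanSpace ℝ (Fin 3))) atTop := by
    have h1 : Tendsto (fun a : (EuclideanSpace ℝ (Fin 3)) => ‖a‖ + -‖x₀ - y₀‖) (cocompact (EuclideanSpace ℝ (Fin 3))) atTop :=
      tendsto_atTop_add_const_right _ _ tendsto_norm_cocompact_atTop
    refine tendsto_atTop_mono (fun a => ?_) h1
    have : ‖a‖ ≤ ‖x₀ - y₀‖ + ‖x₀ - (y₀ + a)‖ := by
      calc ‖a‖ = ‖(x₀ - y₀) - (x₀ - (y₀ + a))‖ := by congr 1; abel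
        _ ≤ ‖x₀ - y₀‖ + ‖x₀ - (y₀ + a)‖ := norm_sub_le _ _
    linarith
  -- `sqSum ≥ ‖x₀ - (y₀ + a)‖² → ∞`
  have hsq : Tendsto (fun a : (EuclideanSpace ℝ (Fin 3)) => sqSum ![x₀, x₁, y₀ + a, y₁ + a]) (cocompact (EuclideanSpace ℝ (Fin 3))) atTop := by
    have h2 : Tendsto (fun a : (EuclideanSpace ℝ (Fin 3)) => ‖x₀ - (y₀ + a)‖ ^ 2) (cocompact (EuclideanSpace ℝ (Fin 3))) atTop :=
      (tendsto_pow_atTop two_ne_zero).comp hg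
    refine tendsto_atTop_mono (fun a => ?_) h2
    have := norm_sub_sq_le_sqSum ![x₀, x₁, y₀ + a, y₁ + a] 0 2
    simpa using this
  have h3 := (tendsto_rpow_neg_atTop (by positivity : 0 < 2 * Δ)).comp hsq
  refine h3.congr fun a => ?_
  simp [bump, Function.comp]

/-- A quadruple with distinct `x₀ ≠ x₁`, `y₀ ≠ y₁` and the second pair translated by `a` is
injective as soon as `a` avoids four points. [folklore] -/
theorem injective_translate_quad {x₀ x₁ y₀ y₁ a : (EuclideanSpace ℝ (Fin 3))} (hx : x₀ ≠ x₁) (hy : y₀ ≠ y₁)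
    (h00 : y₀ + a ≠ x₀) (h01 : y₀ + a ≠ x₁) (h10 : y₁ + a ≠ x₀) (h11 : y₁ + a ≠ x₁) :
    Function.Injective ![x₀, x₁, y₀ + a, y₁ + a] := by
  have hyy : y₀ + a ≠ y₁ + a := fun h => hy (add_right_cancel h)
  intro i j hij
  fin_cases i <;> fin_cases j <;> simp at hij <;> first
    | rfl
    | exact absurd hij hx | exact absurd hij.symm hx
    | exact absurd hij.symm h00 | exact absurd hij h00
    | exact absurd hij.symm h01 | exact absurd hij h01
    | exact absurd hij.symm h10 | exact absurd hij h10
    | exact absurd hij.symm h11 | exact absurd hij h11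
    | exact absurd hij hyy | exact absurd hij.symm hyy
    | exact absurd hij hy | exact absurd hij.symm hy

/-- Eventually along `cocompact`, the translated quadruple is injective. [folklore] -/
theorem eventually_injective_translate {x₀ x₁ y₀ y₁ : (EuclideanSpace ℝ (Fin 3))} (hx : x₀ ≠ x₁) (hy : y₀ ≠ y₁) :
    ∀ᶠ a in cocompact (EuclideanSpace ℝ (Fin 3)), Function.Injective ![x₀, x₁, y₀ + a, y₁ + a] := by
  have hbig : ∀ᶠ a : (EuclideanSpace ℝ (Fin 3)) in cocompact (EuclideanSpace ℝ (Fin 3)), ‖x₀ - y₀‖ + ‖x₁ - y₀‖ + ‖x₀ - y₁‖ + ‖x₁ - y₁‖ < ‖a‖ :=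
    tendsto_norm_cocompact_atTop.eventually_gt_atTop _
  filter_upwards [hbig] with a ha
  refine injective_translate_quad hx hy ?_ ?_ ?_ ?_ <;> intro h
  · have : a = x₀ - y₀ := by rw [← h]; abel
    rw [this] at ha
    linarith [norm_nonneg (x₁ - y₀), norm_nonneg (x₀ - y₁), norm_nonneg (x₁ - y₁)]
  · have : a = x₁ - y₀ := by rw [← h]; abel
    rw [this] at ha
    linarith [norm_nonneg (x₀ - y₀), norm_nonneg (x₀ - y₁), norm_nonneg (x₁ - y₁)]
  · have : a = x₀ - y₁ := by rw [← h]; abel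
    rw [this] at ha
    linarith [norm_nonneg (x₀ - y₀), norm_nonneg (x₁ - y₀), norm_nonneg (x₁ - y₁)]
  · have : a = x₁ - y₁ := by rw [← h]; abel
    rw [this] at ha
    linarith [norm_nonneg (x₀ - y₀), norm_nonneg (x₁ - y₀), norm_nonneg (x₀ - y₁)]

/-- **Clustering (OS axiom E4 shape) of the decoy**: the connected four-point function tends to
`0` when one pair is translated to infinity (`Δ > 0`). So clustering joins the blocked class too. [folklore] -/
theorem cubicFamily_cluster {Δ : ℝ} (hΔ : 0 < Δ) {x₀ x₁ y₀ y₁ : (EuclideanSpace ℝ (Fin 3))} (hx : x₀ ≠ x₁) (hy : y₀ ≠ y₁) :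
    Tendsto (fun a : (EuclideanSpace ℝ (Fin 3)) => limitConnectedFour (cubicFamily Δ) ![x₀, x₁, y₀ + a, y₁ + a])
      (cocompact (EuclideanSpace ℝ (Fin 3))) (𝓝 0) := by
  refine squeeze_zero_norm' ?_ (tendsto_bump_translate hΔ x₀ x₁ y₀ y₁)
  filter_upwards [eventually_injective_translate hx hy] with a ha
  rw [Real.norm_eq_abs]
  exact abs_limitConnectedFour_cubicFamily_le_bump Δ ha

/-! #### Continuity and lattice provenance of the decoy -/

/-- `quartic` is continuous. [folklore] -/
theorem continuous_quartic : Continuous quartic := by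
  unfold quartic
  fun_prop

/-- `aniso` is continuous on non-coincident quadruples. [folklore] -/
theorem continuousOn_aniso : ContinuousOn aniso (NonCoincident 3 4) := by
  unfold aniso
  refine continuous_quartic.continuousOn.div (continuous_sqSum.pow 2).continuousOn fun x hx => ?_
  exact pow_ne_zero 2 (sqSum_pos ((mem_nonCoincident x).1 hx)).ne'

/-- The decoy is continuous on non-coincident configurations, in every arity. [folklore] -/
theorem continuousOn_cubicFamily (Δ : ℝ) (n : ℕ) :
    ContinuousOn (cubicFamily Δ n) (NonCoincident 3 n) := by
  match n with
  | 0 => exact continuousOn_const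
  | 1 => exact continuousOn_const
  | 2 =>
    refine ((continuousOn_twoPt Δ (0 : Fin 2) 1).mono fun x hx => ?_).congr
      fun x _ => cubicFamily_two Δ x
    exact (injective_fin_two_iff x).1 ((mem_nonCoincident x).1 hx)
  | 3 => exact continuousOn_const
  | 4 =>
    have hinj : ∀ x ∈ NonCoincident 3 4, Function.Injective x := fun x hx => (mem_nonCoincident x).1 hx
    have heq : Set.EqOn (cubicFamily Δ 4) (fun x => wick Δ x - bump Δ x * aniso x) (NonCoincident 3 4) :=
      fun x hx => cubicFamily_four_of_injective Δ (hinj x hx)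
    refine ContinuousOn.congr ?_ heq
    have htp : ∀ i j : Fin 4, i ≠ j →
        ContinuousOn (fun x : Fin 4 → (EuclideanSpace ℝ (Fin 3)) => twoPt Δ (x i) (x j)) (NonCoincident 3 4) :=
      fun i j hij => (continuousOn_twoPt Δ i j).mono fun x hx h => hij (hinj x hx h)
    refine ContinuousOn.sub ?_ (ContinuousOn.mul ?_ continuousOn_aniso)
    · unfold wick
      exact (((htp 0 1 (by decide)).mul (htp 2 3 (by decide))).add
        ((htp 0 2 (by decide)).mul (htp 1 3 (by decide)))).add
        ((htp 0 3 (by decide)).mul (htp 1 2 (by decide)))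
    · unfold bump
      exact ContinuousOn.rpow_const (continuous_sqSum.continuousOn) fun x hx =>
        Or.inl (sqSum_pos (hinj x hx)).ne'
  | (n + 5) => exact continuousOn_const

/-- The decoy sampled on `ℤ³`: its lattice precursor. [folklore] -/
def cubicLattice (Δ : ℝ) : LatticeCorrFamily 3 := fun n k =>
  cubicFamily Δ n (fun i => (WithLp.toLp 2 fun j => ((k i j : ℤ) : ℝ) : (EuclideanSpace ℝ (Fin 3))))

/-- **The cubic decoy is a lattice scaling limit**: with `ρ δ = δ^{-Δ}`,
`HasPointwiseScalingLimit (cubicLattice Δ) ρ (cubicFamily Δ)` (scale covariance turns the rescaled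
correlator into the decoy at the rounded configuration; continuity on `NonCoincident` and the
`3δ` rounding bound give locally uniform convergence — the barrier's approximation lemma).
[folklore] -/
theorem cubicFamily_hasPointwiseScalingLimit (Δ : ℝ) :
    HasPointwiseScalingLimit (cubicLattice Δ) (fun δ => δ ^ (-Δ)) (cubicFamily Δ) := by
  intro n
  have key : ∀ δ, 0 < δ → ∀ x : Fin n → (EuclideanSpace ℝ (Fin 3)),
      rescaledCorrelator (cubicLattice Δ) (fun δ => δ ^ (-Δ)) n δ x =
        cubicFamily Δ n (fun i => δ • (WithLp.toLp 2 fun j => ((latticeApprox δ (x i) j : ℤ) : ℝ) : (EuclideanSpace ℝ (Fin 3)))) := by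
    intro δ hδ x
    rw [rescaledCorrelator_apply, cubicFamily_isScaleCovariant Δ n δ hδ]
    unfold cubicLattice
    congr 1
    rw [← Real.rpow_natCast, ← Real.rpow_mul hδ.le]
    congr 1
    ring
  have happrox := tendstoLocallyUniformlyOn_comp_approx (isOpen_nonCoincident 3 n)
    (continuousOn_cubicFamily Δ n)
    (fun δ x i => δ • (WithLp.toLp 2 fun j => ((latticeApprox δ (x i) j : ℤ) : ℝ) : (EuclideanSpace ℝ (Fin 3)))) 3
    (fun δ hδ x => dist_round_le hδ x)
  refine tendstoLocallyUniformlyOn_congr_eventually happrox ?_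
  filter_upwards [self_mem_nhdsWithin] with δ hδ x _
  exact (key δ hδ x).symm

/-! ### The cubic decoy is NOT reflection positive: OS positivity stays an admissible lever -/

/-- `S₄ > 0` of the decoy at non-coincident quadruples (`Δ ≥ 0`). [folklore] -/
theorem cubicFamily_four_pos {Δ : ℝ} (hΔ : 0 ≤ Δ) {x : Fin 4 → (EuclideanSpace ℝ (Fin 3))} (hx : Function.Injective x) :
    0 < cubicFamily Δ 4 x := by
  rw [cubicFamily_four_of_injective Δ hx]
  have h01 : x 0 ≠ x 1 := hx.ne (by decide)
  have h23 : x 2 ≠ x 3 := hx.ne (by decide)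
  have h02 : x 0 ≠ x 2 := hx.ne (by decide)
  have h13 : x 1 ≠ x 3 := hx.ne (by decide)
  have hb : bump Δ x * aniso x ≤ twoPt Δ (x 0) (x 1) * twoPt Δ (x 2) (x 3) :=
    calc bump Δ x * aniso x ≤ bump Δ x * 1 :=
          mul_le_mul_of_nonneg_left (aniso_le_one x) (bump_nonneg Δ x)
      _ ≤ twoPt Δ (x 0) (x 1) * twoPt Δ (x 2) (x 3) := by
          rw [mul_one]; exact bump_le_twoPt_mul_twoPt hΔ h01 h23
  have hpos : 0 < twoPt Δ (x 0) (x 2) * twoPt Δ (x 1) (x 3) :=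
    mul_pos (twoPt_pos Δ h02) (twoPt_pos Δ h13)
  have hw := twoPt_nonneg Δ
  unfold wick
  nlinarith [mul_nonneg (hw (x 0) (x 3)) (hw (x 1) (x 2))]

/-- **The cubic decoy is NOT reflection positive** along any coordinate axis (`Δ ≥ 0`): as for the
barrier witness, the OS Gram matrix of "three spins at `e_τ,2e_τ,3e_τ`" versus "one spin at `4e_τ`"
has diagonal entry `S₆ = 0` and positive off-diagonal entries `S₄ > 0` (OS Cauchy–Schwarz). So the
no-go class of this file is DISJOINT from reflection positivity: nine-mirror OS positivity of all orders
(the route's intended engine "NineDirectionOS → ContinuationB3") is untouched by it. [folklore] -/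
theorem cubicFamily_not_reflectionPositive {Δ : ℝ} (hΔ : 0 ≤ Δ) (τ : Fin 3) :
    ¬ IsReflectionPositiveAlong τ (cubicFamily Δ) := by
  intro hRP
  let A : HalfSpaceConfig 3 τ :=
    { n := 3
      pts := fun i => EuclideanSpace.single τ (((i : ℕ) : ℝ) + 1)
      injective := by
        intro i j hij
        have h : ((i : ℕ) : ℝ) + 1 = ((j : ℕ) : ℝ) + 1 := by
          simpa using congrArg (fun z : EuclideanSpace ℝ (Fin 3) => z τ) hij
        exact Fin.ext (Nat.cast_injective (R := ℝ) (by linarith))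
      pos := fun i => by simp; positivity }
  let B : HalfSpaceConfig 3 τ :=
    { n := 1
      pts := fun _ => EuclideanSpace.single τ 4
      injective := Function.injective_of_subsingleton _
      pos := fun i => by simp }
  have hAA : osPointKernel (cubicFamily Δ) A A = 0 := rfl
  have hAB : 0 < osPointKernel (cubicFamily Δ) A B :=
    cubicFamily_four_pos hΔ (osPointKernel_arg_injective A B)
  have hBA : 0 < osPointKernel (cubicFamily Δ) B A :=
    cubicFamily_four_pos hΔ (osPointKernel_arg_injective B A)
  have hBB : 0 < osPointKernel (cubicFamily Δ) B B := by
    have hinj := osPointKernel_arg_injective B B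
    show 0 < cubicFamily Δ 2 _
    rw [cubicFamily_two]
    exact twoPt_pos Δ (hinj.ne (show (0 : Fin 2) ≠ 1 by decide))
  set s := osPointKernel (cubicFamily Δ) A B with hs
  set s' := osPointKernel (cubicFamily Δ) B A with hs'
  set t := osPointKernel (cubicFamily Δ) B B with ht
  have key := hRP 2 ![A, B] ![t, -(s + s') / 2]
  simp only [Fin.sum_univ_two, Matrix.cons_val_zero, Matrix.cons_val_one] at key
  rw [hAA, ← hs, ← hs', ← ht] at key
  nlinarith [mul_pos hBB (mul_pos (add_pos hAB hBA) (add_pos hAB hBA))]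

end Summit.CriticalPhenomena.Ising3DConformalLimit.RotationUpgradeFromTwoPointNegative

end
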